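import Summits.AnomalousDissipation.AnomalousDissipation.Theorems.SolenoidalFractalHomogenisationLagrangianStepSidebandDefs
import Literature.Analysis.FluidPDE.PassiveVectorTensorTwistedModalSymbol
import HarnessLib

/-!
# K1L_D `LagrangianRenormalisationStepDesign` (stmt-AnomalousDissipation-27980), registered stub `stub_D1_V0θg` (v28, ruling D28-3 (3)), port-map layer L4:
# the FROZEN-FRAME (`G₀`-twisted) truncated `ξ = 0` sideband system, its periodic linear response, the period-mean feedback and the c-free map `psiStarθ`
# — the DEFORMED cell word's exact effective tensor (shared definitions; reviewed; `--kind definition --supports stmt-AnomalousDissipation-27980 --as helper`)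

Summits-side DEFINITIONS file of route `SolenoidalFractalHomogenisation` (prover seat `ad-k1l-cellLawV-w1` g9; port map
`Cruxes/LagrangianRenormalisationStepDesign/Lines/onelevel-vtheta-twist-portmap.md` §3 L4).  The frozen-frame twin of `…SidebandDefs` (brick T1 of the V0
architecture): definitions with bodies and unfolding / consistency lemmas only; no theorems of substance, no named facts, no sorry.

THE TWIST (`Literature/…/PassiveVectorTensorDistortedConstFrameFourier`, `…TwistedModalSymbol`; `…CellChainLinksFrame`, `…CellChainDefsFrame`): for the cell member of
the graded frozen-frame cell law `VmodDist.SlowVectorClauseFθg` (constant frame `G₀`) the chain of a weak solution in the class `k = ℓ + n·z` reads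
`y_z' = −4π² P^θ_{z+ξ} T_{(𝔸^{G₀})ᵀ}(z+ξ) y_z − Σⱼ 2πi(êⱼ·(z+ξ)) envⱼ(t) [αⱼ P^θ y_{z−mⱼ} + ᾱⱼ P^θ y_{z+mⱼ}]` with the TWISTED Leray projections
`P^θ_w := transversalProjR (twistFreq G₀ w)` (onto `(G₀ᵀw)^⊥`) and the symbol of the conjugated tensor `𝔸^{G₀} = Visc4.conj G₀ 𝔸`; the link factors `êⱼ·w`, the
envelopes, the amplitudes `αⱼ`, the box `box R`, the state space `Space R`, `coordL` and the FEEDBACK functional `feedback` (no projection inside) are the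
flat ones, REUSED BY NAME.  Hence, with `G₀` as an extra argument everywhere:
* `genCompθ / genθ W₁ 𝔸 G₀ γ₁ R t` — the twisted augmented truncated `ξ = 0` fast generator (`−γ₁(1 − P^θ_z)` damping of the twisted-longitudinal components);
* `sourceCompθ / sourceθ W₁ G₀ R j t` — the twisted unit source of slot `j` (`P^θ_{±mⱼ}`);
* `IsPeriodicResponseθ`, `responseθ W₁ 𝔸 G₀ γ₁ R j`, `meanFeedbackθ W₁ 𝔸 G₀ γ₁ R j j'` — the periodic linear response and the matrices `M^θ_{jj'}`;
* **`psiStarθ W M hM ν S G₀`** — the c-free exact effective map OF THE DEFORMED WORD: `psiStar`'s formula with `M^θ_{jj'}` (the slow equation's link factors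
  `êⱼ·ℓ` stay flat, so the index placement is unchanged: `T_{(psiStarθ)ᵀ}(q) z = (ν/(4π²)) Σ_{jj'} (êⱼ·q)(ê_{j'}·q) (Re M^θ_{jj'}) z`);
* `genCompθ_one`, `genθ_one`, `sourceCompθ_one`, `sourceθ_one`, `isPeriodicResponseθ_one_iff`, `responseθ_one`, `meanFeedbackθ_one`, **`psiStarθ_one`** — at `G₀ = 1`
  every twisted object IS the flat one (`transversalProjR_intCast`, `twistFreq_one`, `Visc4.conj_one`), so the θ = 0 member of (V_θg) is served by the V0R chain.
The mismatch `psiStarθ … G₀ − psiStar …` (O(θ), the port map's layer L6) is what the graded allowance `θ ^ σ` of `SlowVectorClauseFθg` pays for.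
NOT a proof of anything; rung F-D1.A0 infrastructure.  AD is not proved.
-/

set_option linter.dupNamespace false

noncomputable section

namespace Summit.AnomalousDissipation.AnomalousDissipation.Theorems.SolenoidalFractalHomogenisation.LagrangianStep.Sideband

open Set MeasureTheory Complex UnitAddTorus
open scoped InnerProductSpace
open Literature.Analysis Literature.Analysis.FunctionSpaces Literature.Analysis.FunctionSpaces.Torus
open Literature.Analysis.FluidPDE Literature.Analysis.FluidPDE.Torus Literature.Analysis.FluidPDE.LatticeShear
open Summit.AnomalousDissipation.AnomalousDissipation.Theorems.SolenoidalFractalHomogenisation.LagrangianStep.CellChain (linkCoeff)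

variable {k₀ : ℕ}

/-! ## §1 The twisted truncated `ξ = 0` fast generator and the twisted unit sources -/

/-- **The `z`-component of the twisted augmented truncated `ξ = 0` fast generator**:
`y ↦ −4π² P^θ_z T_{(𝔸^{G₀})ᵀ}(z) P^θ_z y_z − γ₁ (y_z − P^θ_z y_z) − Σⱼ linkCoeffⱼ(z,t) • P^θ_z (αⱼ P^θ_{z−mⱼ} y_{z−mⱼ} + ᾱⱼ P^θ_{z+mⱼ} y_{z+mⱼ})`
(`P^θ_w = transversalProjR (twistFreq G₀ w)`, `linkCoeff` at `n = 1`; neighbours outside the box read as `0`).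
[cite: MajdaKramer1999, §2.2.1.3 (cell problem (49))] [cite: ArmstrongVicol2025, §4.1 (PDF p. 34)] -/
def genCompθ (W₁ : LatticeWord k₀) (𝔸 : Torus.Visc4 (Fin 3)) (G₀ : Matrix (Fin 3) (Fin 3) ℝ) (γ₁ : ℝ) (R : ℕ) (t : ℝ) (z : box R) :
    Space R →L[ℂ] EuclideanSpace ℂ (Fin 3) :=
  -((((4 * Real.pi ^ 2 : ℝ) : ℂ)) • ((transversalProjR (twistFreq G₀ z.1)).comp ((symbTL (Torus.majorTranspose (Torus.Visc4.conj G₀ 𝔸)) z.1).comp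
      ((transversalProjR (twistFreq G₀ z.1)).comp (coordL R z.1))))) -
    ((γ₁ : ℝ) : ℂ) • (coordL R z.1 - (transversalProjR (twistFreq G₀ z.1)).comp (coordL R z.1)) -
    ∑ j, linkCoeff W₁ 1 z.1 j t • ((transversalProjR (twistFreq G₀ z.1)).comp
      (slotAmp W₁ j • ((transversalProjR (twistFreq G₀ (z.1 - (W₁.phase j).m))).comp (coordL R (z.1 - (W₁.phase j).m))) +
        starRingEnd ℂ (slotAmp W₁ j) • ((transversalProjR (twistFreq G₀ (z.1 + (W₁.phase j).m))).comp (coordL R (z.1 + (W₁.phase j).m)))))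

/-- **The twisted augmented truncated `ξ = 0` fast generator** `genθ … t : Space R →L[ℂ] Space R` (components `genCompθ`). [cite: MajdaKramer1999, §2.2.1.3] -/
def genθ (W₁ : LatticeWord k₀) (𝔸 : Torus.Visc4 (Fin 3)) (G₀ : Matrix (Fin 3) (Fin 3) ℝ) (γ₁ : ℝ) (R : ℕ) (t : ℝ) : Space R →L[ℂ] Space R :=
  ((PiLp.continuousLinearEquiv 2 ℂ (fun _ : box R => EuclideanSpace ℂ (Fin 3))).symm : (box R → EuclideanSpace ℂ (Fin 3)) →L[ℂ] Space R).comp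
    (ContinuousLinearMap.pi fun z => genCompθ W₁ 𝔸 G₀ γ₁ R t z)

/-- Components of `genθ`. [cite: MajdaKramer1999, §2.2.1.3] -/
theorem genθ_apply (W₁ : LatticeWord k₀) (𝔸 : Torus.Visc4 (Fin 3)) (G₀ : Matrix (Fin 3) (Fin 3) ℝ) (γ₁ : ℝ) (R : ℕ) (t : ℝ) (y : Space R) (z : box R) :
    genθ W₁ 𝔸 G₀ γ₁ R t y z = genCompθ W₁ 𝔸 G₀ γ₁ R t z y := by
  simp [genθ]

/-- **The `z`-component of the twisted unit source of slot `j`**: `−2πi·envⱼ(t)·αⱼ·P^θ_{mⱼ} v` at `z = mⱼ`, `−2πi·envⱼ(t)·ᾱⱼ·P^θ_{−mⱼ} v` at `z = −mⱼ`, else `0`.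
[cite: MajdaKramer1999, §2.2.1.3 (cell problem (49), source term)] [cite: ArmstrongVicol2025, §4.1 (PDF p. 34)] -/
def sourceCompθ (W₁ : LatticeWord k₀) (G₀ : Matrix (Fin 3) (Fin 3) ℝ) (R : ℕ) (j : Fin k₀) (t : ℝ) (z : box R) :
    EuclideanSpace ℂ (Fin 3) →L[ℂ] EuclideanSpace ℂ (Fin 3) :=
  (if z.1 = (W₁.phase j).m then (-(2 * Real.pi * Complex.I * ((slotEnvelope W₁ j t : ℝ) : ℂ) * slotAmp W₁ j)) • transversalProjR (twistFreq G₀ z.1) else 0) +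
  (if z.1 = -(W₁.phase j).m then
      (-(2 * Real.pi * Complex.I * ((slotEnvelope W₁ j t : ℝ) : ℂ) * starRingEnd ℂ (slotAmp W₁ j))) • transversalProjR (twistFreq G₀ z.1)
    else 0)

/-- **The twisted unit source of slot `j`** `sourceθ … j t : ℂ³ →L[ℂ] Space R`. [cite: MajdaKramer1999, §2.2.1.3] -/
def sourceθ (W₁ : LatticeWord k₀) (G₀ : Matrix (Fin 3) (Fin 3) ℝ) (R : ℕ) (j : Fin k₀) (t : ℝ) : EuclideanSpace ℂ (Fin 3) →L[ℂ] Space R :=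
  ((PiLp.continuousLinearEquiv 2 ℂ (fun _ : box R => EuclideanSpace ℂ (Fin 3))).symm : (box R → EuclideanSpace ℂ (Fin 3)) →L[ℂ] Space R).comp
    (ContinuousLinearMap.pi fun z => sourceCompθ W₁ G₀ R j t z)

/-- Components of `sourceθ`. [cite: MajdaKramer1999, §2.2.1.3] -/
theorem sourceθ_apply (W₁ : LatticeWord k₀) (G₀ : Matrix (Fin 3) (Fin 3) ℝ) (R : ℕ) (j : Fin k₀) (t : ℝ) (v : EuclideanSpace ℂ (Fin 3)) (z : box R) :
    sourceθ W₁ G₀ R j t v z = sourceCompθ W₁ G₀ R j t z v := by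
  simp [sourceθ]

/-! ## §2 The twisted periodic linear response and the period-mean feedback matrices -/

/-- **Twisted periodic linear response of slot `j`**: `N` is continuous on `[0,P]`, solves `N' = sourceθⱼ + genθ ∘ N` on `[0,P)` and closes up, `N P = N 0`
(`P = W₁.period`). [cite: SandersVerhulstMurdock2007, Lemma 5.2.7 (linear case)] -/
def IsPeriodicResponseθ (W₁ : LatticeWord k₀) (𝔸 : Torus.Visc4 (Fin 3)) (G₀ : Matrix (Fin 3) (Fin 3) ℝ) (γ₁ : ℝ) (R : ℕ) (j : Fin k₀)
    (N : ℝ → (EuclideanSpace ℂ (Fin 3) →L[ℝ] Space R)) : Prop :=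
  ContinuousOn N (Icc 0 W₁.period) ∧
  (∀ t ∈ Ico 0 W₁.period, HasDerivAt N ((sourceθ W₁ G₀ R j t).restrictScalars ℝ + ((genθ W₁ 𝔸 G₀ γ₁ R t).restrictScalars ℝ).comp (N t)) t) ∧
  N W₁.period = N 0

/-- **THE twisted periodic linear response of slot `j`** (by `Exists.choose`; `0` if there is none). [cite: SandersVerhulstMurdock2007, Lemma 5.2.7 (linear case)] -/
def responseθ (W₁ : LatticeWord k₀) (𝔸 : Torus.Visc4 (Fin 3)) (G₀ : Matrix (Fin 3) (Fin 3) ℝ) (γ₁ : ℝ) (R : ℕ) (j : Fin k₀) :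
    ℝ → (EuclideanSpace ℂ (Fin 3) →L[ℝ] Space R) :=
  open Classical in
  if h : ∃ N, IsPeriodicResponseθ W₁ 𝔸 G₀ γ₁ R j N then h.choose else 0

/-- The chosen twisted response is a periodic response whenever one exists. [cite: SandersVerhulstMurdock2007, Lemma 5.2.7 (linear case)] -/
theorem isPeriodicResponseθ_responseθ {W₁ : LatticeWord k₀} {𝔸 : Torus.Visc4 (Fin 3)} {G₀ : Matrix (Fin 3) (Fin 3) ℝ} {γ₁ : ℝ} {R : ℕ} {j : Fin k₀}
    (h : ∃ N, IsPeriodicResponseθ W₁ 𝔸 G₀ γ₁ R j N) : IsPeriodicResponseθ W₁ 𝔸 G₀ γ₁ R j (responseθ W₁ 𝔸 G₀ γ₁ R j) := by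
  classical
  rw [responseθ, dif_pos h]
  exact h.choose_spec

/-- **The twisted period-mean feedback matrix** `M^θ_{jj'} := (1/P) ∫₀^P feedbackⱼ(t) ∘ responseθ_{j'}(t) dt : ℂ³ →L[ℝ] ℂ³` (the feedback functional has no
projection inside and is the flat one). [cite: MajdaKramer1999, §2.2.1.3 (55) (effective diffusivity as a cell average)] -/
def meanFeedbackθ (W₁ : LatticeWord k₀) (𝔸 : Torus.Visc4 (Fin 3)) (G₀ : Matrix (Fin 3) (Fin 3) ℝ) (γ₁ : ℝ) (R : ℕ) (j j' : Fin k₀) :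
    EuclideanSpace ℂ (Fin 3) →L[ℝ] EuclideanSpace ℂ (Fin 3) :=
  (1 / W₁.period) • ∫ t in (0:ℝ)..W₁.period, ((feedback W₁ R j t).restrictScalars ℝ).comp (responseθ W₁ 𝔸 G₀ γ₁ R j' t)

/-! ## §3 The c-free exact effective map of the DEFORMED word -/

/-- **The c-free exact effective map of the word `W` at pre-stretch `M` in the frozen frame `G₀`**: for `ν > 0`, with `W₁ = (W.stretch M).stretch (1/ν)`,
`𝔸 = ν•S`, `γ₁ = 1`, `R = R0 ν`, `psiStarθ i a l b = (ν/(4π²)) · Σ_{j j'} (ê_{j'})_a (êⱼ)_b · Re ((M^θ_{jj'} e_l)_i)`; `0` for `ν ≤ 0`.  At `G₀ = 1` it is `psiStar`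
(`psiStarθ_one`); in general it is the homogenised tensor of the affinely deformed word (wavevectors `G₀ᵀmⱼ`, amplitudes `G₀⁻¹êⱼ`), seen in y-space.
[cite: MajdaKramer1999, §2.2.1.3 (55) (effective diffusivity)] [cite: ArmstrongVicol2025, §4.1 (PDF p. 34)] -/
def psiStarθ (W : LatticeWord k₀) (M : ℝ) (hM : 0 < M) (ν : ℝ) (S : Torus.Visc4 (Fin 3)) (G₀ : Matrix (Fin 3) (Fin 3) ℝ) : Torus.Visc4 (Fin 3) :=
  if hν : 0 < ν then
    fun i a l b => ν / (4 * Real.pi ^ 2) * ∑ j : Fin k₀, ∑ j' : Fin k₀,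
      (((W.stretch M hM).stretch (1 / ν) (one_div_pos.mpr hν)).phase j').e a *
      (((W.stretch M hM).stretch (1 / ν) (one_div_pos.mpr hν)).phase j).e b *
      ((meanFeedbackθ ((W.stretch M hM).stretch (1 / ν) (one_div_pos.mpr hν)) (ν • S) G₀ 1 (R0 ν) j j'
        (EuclideanSpace.single l (1:ℂ))) i).re
  else fun _ _ _ _ => 0

/-- `psiStarθ` vanishes off `ν > 0`. [cite: MajdaKramer1999, §2.2.1.3] -/
theorem psiStarθ_of_not_pos (W : LatticeWord k₀) (M : ℝ) (hM : 0 < M) {ν : ℝ} (hν : ¬ 0 < ν) (S : Torus.Visc4 (Fin 3))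
    (G₀ : Matrix (Fin 3) (Fin 3) ℝ) : psiStarθ W M hM ν S G₀ = fun _ _ _ _ => 0 := by
  simp [psiStarθ, hν]

/-- Unfolding `psiStarθ` for `ν > 0`. [cite: MajdaKramer1999, §2.2.1.3] -/
theorem psiStarθ_of_pos (W : LatticeWord k₀) (M : ℝ) (hM : 0 < M) {ν : ℝ} (hν : 0 < ν) (S : Torus.Visc4 (Fin 3)) (G₀ : Matrix (Fin 3) (Fin 3) ℝ)
    (i a l b : Fin 3) :
    psiStarθ W M hM ν S G₀ i a l b = ν / (4 * Real.pi ^ 2) * ∑ j : Fin k₀, ∑ j' : Fin k₀,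
      (((W.stretch M hM).stretch (1 / ν) (one_div_pos.mpr hν)).phase j').e a *
      (((W.stretch M hM).stretch (1 / ν) (one_div_pos.mpr hν)).phase j).e b *
      ((meanFeedbackθ ((W.stretch M hM).stretch (1 / ν) (one_div_pos.mpr hν)) (ν • S) G₀ 1 (R0 ν) j j'
        (EuclideanSpace.single l (1:ℂ))) i).re := by
  simp [psiStarθ, hν]

/-! ## §4 Consistency at the identity frame: every twisted object is the flat one at `G₀ = 1` -/

/-- The twisted projection at an integer point in the identity frame is the flat Leray projection. [cite: Temam1984, Ch. III §1.1] -/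
theorem transversalProjR_twistFreq_one (w : Fin 3 → ℤ) : transversalProjR (twistFreq (1 : Matrix (Fin 3) (Fin 3) ℝ) w) = transversalProj w := by
  rw [twistFreq_one, transversalProjR_intCast]

/-- `genCompθ … 1 … = genComp …`. [cite: MajdaKramer1999, §2.2.1.3] -/
theorem genCompθ_one (W₁ : LatticeWord k₀) (𝔸 : Torus.Visc4 (Fin 3)) (γ₁ : ℝ) (R : ℕ) (t : ℝ) (z : box R) :
    genCompθ W₁ 𝔸 1 γ₁ R t z = genComp W₁ 𝔸 γ₁ R t z := by
  have hP : ∀ w : Fin 3 → ℤ, transversalProjR (twistFreq (1 : Matrix (Fin 3) (Fin 3) ℝ) w) = transversalProj w :=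
    transversalProjR_twistFreq_one
  have hA : Torus.Visc4.conj (1 : Matrix (Fin 3) (Fin 3) ℝ) 𝔸 = 𝔸 := Torus.Visc4.conj_one 𝔸
  unfold genCompθ genComp
  rw [hA, hP z.1]
  congr 1
  refine Finset.sum_congr rfl fun j _ => ?_
  rw [hP, hP]

/-- `genθ … 1 … = gen …`. [cite: MajdaKramer1999, §2.2.1.3] -/
theorem genθ_one (W₁ : LatticeWord k₀) (𝔸 : Torus.Visc4 (Fin 3)) (γ₁ : ℝ) (R : ℕ) (t : ℝ) : genθ W₁ 𝔸 1 γ₁ R t = gen W₁ 𝔸 γ₁ R t := by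
  ext y z
  rw [genθ_apply, gen_apply, genCompθ_one]

/-- `sourceCompθ … 1 … = sourceComp …`. [cite: MajdaKramer1999, §2.2.1.3] -/
theorem sourceCompθ_one (W₁ : LatticeWord k₀) (R : ℕ) (j : Fin k₀) (t : ℝ) (z : box R) :
    sourceCompθ W₁ 1 R j t z = sourceComp W₁ R j t z := by
  unfold sourceCompθ sourceComp
  simp only [transversalProjR_twistFreq_one]

/-- `sourceθ … 1 … = source …`. [cite: MajdaKramer1999, §2.2.1.3] -/
theorem sourceθ_one (W₁ : LatticeWord k₀) (R : ℕ) (j : Fin k₀) (t : ℝ) : sourceθ W₁ 1 R j t = source W₁ R j t := by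
  ext v z
  rw [sourceθ_apply, source_apply, sourceCompθ_one]

/-- `IsPeriodicResponseθ … 1 … N ↔ IsPeriodicResponse … N`. [cite: SandersVerhulstMurdock2007, Lemma 5.2.7 (linear case)] -/
theorem isPeriodicResponseθ_one_iff (W₁ : LatticeWord k₀) (𝔸 : Torus.Visc4 (Fin 3)) (γ₁ : ℝ) (R : ℕ) (j : Fin k₀)
    (N : ℝ → (EuclideanSpace ℂ (Fin 3) →L[ℝ] Space R)) :
    IsPeriodicResponseθ W₁ 𝔸 1 γ₁ R j N ↔ IsPeriodicResponse W₁ 𝔸 γ₁ R j N := by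
  unfold IsPeriodicResponseθ IsPeriodicResponse
  simp only [sourceθ_one, genθ_one]

/-- `responseθ … 1 … = response …`. [cite: SandersVerhulstMurdock2007, Lemma 5.2.7 (linear case)] -/
theorem responseθ_one (W₁ : LatticeWord k₀) (𝔸 : Torus.Visc4 (Fin 3)) (γ₁ : ℝ) (R : ℕ) (j : Fin k₀) :
    responseθ W₁ 𝔸 1 γ₁ R j = response W₁ 𝔸 γ₁ R j := by
  classical
  have h : (fun N => IsPeriodicResponseθ W₁ 𝔸 1 γ₁ R j N) = fun N => IsPeriodicResponse W₁ 𝔸 γ₁ R j N :=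
    funext fun N => propext (isPeriodicResponseθ_one_iff W₁ 𝔸 γ₁ R j N)
  unfold responseθ response
  simp only [h]

/-- `meanFeedbackθ … 1 … = meanFeedback …`. [cite: MajdaKramer1999, §2.2.1.3 (55)] -/
theorem meanFeedbackθ_one (W₁ : LatticeWord k₀) (𝔸 : Torus.Visc4 (Fin 3)) (γ₁ : ℝ) (R : ℕ) (j j' : Fin k₀) :
    meanFeedbackθ W₁ 𝔸 1 γ₁ R j j' = meanFeedback W₁ 𝔸 γ₁ R j j' := by
  unfold meanFeedbackθ meanFeedback
  simp only [responseθ_one]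

/-- **`psiStarθ … 1 = psiStar …`**: the exact effective map of the undeformed word is the θ = 0 member of the twisted family.
[cite: MajdaKramer1999, §2.2.1.3 (55) (effective diffusivity)] -/
theorem psiStarθ_one (W : LatticeWord k₀) (M : ℝ) (hM : 0 < M) (ν : ℝ) (S : Torus.Visc4 (Fin 3)) :
    psiStarθ W M hM ν S 1 = psiStar W M hM ν S := by
  by_cases hν : 0 < ν
  · funext i a l b
    rw [psiStarθ_of_pos W M hM hν, psiStar_of_pos W M hM hν]
    simp only [meanFeedbackθ_one]
  · rw [psiStarθ_of_not_pos W M hM hν, psiStar_of_not_pos W M hM hν]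

end Summit.AnomalousDissipation.AnomalousDissipation.Theorems.SolenoidalFractalHomogenisation.LagrangianStep.Sideband

end
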